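import Summits.KontsevichZagierPeriods.KontsevichZagierPeriods.Theorems.FurushoPentagonStuffleInKZDefs
import Literature.NumberTheory.Transcendental.KZProductIdeal

/-!
# `StuffleInKZ` (stmt-KontsevichZagierPeriods-3931), line `cumulative-cube-lattice-paths`:
# term transport (stub `stub_termTransport`)

Step 5 of the cube line: every summand `pathKernel s t p xs ys` of the cube kernel identity
(one per lattice path `p` from `(0,0)` to `(|s|,|t|)`) is, after ONE coordinate permutation of the
big cube `(0,1)^{a+b}` (`a = weight s`, `b = weight t`), the cube kernel of the merged index
`u = merge p s t`:

* `weight_merge`, `length_merge` — `u` has weight `a + b` and one entry per step;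
* `interleave_map`, `interleave_perm` — block interleaving commutes with `List.map` and permutes
  `xs ++ ys`; hence (`interleave_idx_perm`) the interleaved index list is an enumeration of
  `Fin (a+b)` and defines, by `List.Nodup.getEquivOfForallMemList`, the block-interleaving
  permutation;
* `prod_take_interleave`, `cubeKernel_merge_interleave` — the KEY IDENTITY
  `cubeKernel (merge p s t) (interleave p s t xs ys) = pathKernel s t p xs ys`: the partial product
  of the interleaved coordinates up to the `m`-th cumulative position of `u` is the node product
  `nodeProd s t p xs ys m`;
* `stub_termTransport` — the transported representation is `C.reindex e` along that permutation
  (`KZ.IntegralRep.reindex`), a change-of-variables move (`KZ.of_sub_of_reindex_mem_relations`).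

References: M. Kontsevich, D. Zagier, *Periods* (2001), §1.2 rule (2); I. Soudères, *Motivic
double shuffle*, IJNT 6 (2010), §1.3 Prop. 1.5; M. Hoffman, J. Algebra 194 (1997), §2.
-/

noncomputable section

open Set MeasureTheory
open Literature.NumberTheory.Transcendental
open Literature.NumberTheory.Transcendental.KZ
open Literature.NumberTheory.Transcendental.MZV (weight)

namespace Summit.KontsevichZagierPeriods.FurushoPentagon.StuffleInKZ

/-! ### Weight and length of the merged index -/

/-- `weight (a :: s) = a + weight s`. [folklore] -/
theorem weight_cons_eq (a : ℕ) (s : List ℕ) : weight (a :: s) = a + weight s := List.sum_cons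

/-- Along a path consuming exactly `s` and `t`, the merged index has weight `weight s + weight t`.
[cite: Hoffman1997, §2 (A3)] -/
theorem weight_merge : ∀ (p : List Step) (s t : List ℕ), cx p = s.length → cy p = t.length →
    weight (merge p s t) = weight s + weight t
  | [], s, t, hs, ht => by
    rw [cx_nil] at hs
    rw [cy_nil] at ht
    obtain rfl := List.eq_nil_of_length_eq_zero hs.symm
    obtain rfl := List.eq_nil_of_length_eq_zero ht.symm
    simp
  | Step.X :: p, [], t, hs, _ => by simp at hs
  | Step.X :: p, a :: s, t, hs, ht => by
    rw [cx_cons_X, List.length_cons, Nat.add_right_cancel_iff] at hs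
    rw [cy_cons_X] at ht
    rw [merge_X_cons, weight_cons_eq, weight_cons_eq, weight_merge p s t hs ht, Nat.add_assoc]
  | Step.Y :: p, s, [], _, ht => by simp at ht
  | Step.Y :: p, s, b :: t, hs, ht => by
    rw [cx_cons_Y] at hs
    rw [cy_cons_Y, List.length_cons, Nat.add_right_cancel_iff] at ht
    rw [merge_Y_cons, weight_cons_eq, weight_cons_eq, weight_merge p s t hs ht]
    omega
  | Step.D :: p, [], t, hs, _ => by simp at hs
  | Step.D :: p, a :: s, [], _, ht => by simp at ht
  | Step.D :: p, a :: s, b :: t, hs, ht => by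
    rw [cx_cons_D, List.length_cons, Nat.add_right_cancel_iff] at hs
    rw [cy_cons_D, List.length_cons, Nat.add_right_cancel_iff] at ht
    rw [merge_D_cons, weight_cons_eq, weight_cons_eq, weight_cons_eq, weight_merge p s t hs ht]
    omega

/-- Along a path consuming exactly `s` and `t`, the merged index has one entry per step.
[cite: Hoffman1997, §2 (A3)] -/
theorem length_merge : ∀ (p : List Step) (s t : List ℕ), cx p = s.length → cy p = t.length →
    (merge p s t).length = p.length
  | [], s, t, _, _ => by simp
  | Step.X :: p, [], t, hs, _ => by simp at hs
  | Step.X :: p, a :: s, t, hs, ht => by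
    rw [cx_cons_X, List.length_cons, Nat.add_right_cancel_iff] at hs
    rw [cy_cons_X] at ht
    rw [merge_X_cons, List.length_cons, List.length_cons, length_merge p s t hs ht]
  | Step.Y :: p, s, [], _, ht => by simp at ht
  | Step.Y :: p, s, b :: t, hs, ht => by
    rw [cx_cons_Y] at hs
    rw [cy_cons_Y, List.length_cons, Nat.add_right_cancel_iff] at ht
    rw [merge_Y_cons, List.length_cons, List.length_cons, length_merge p s t hs ht]
  | Step.D :: p, [], t, hs, _ => by simp at hs
  | Step.D :: p, a :: s, [], _, ht => by simp at ht
  | Step.D :: p, a :: s, b :: t, hs, ht => by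
    rw [cx_cons_D, List.length_cons, Nat.add_right_cancel_iff] at hs
    rw [cy_cons_D, List.length_cons, Nat.add_right_cancel_iff] at ht
    rw [merge_D_cons, List.length_cons, List.length_cons, length_merge p s t hs ht]

/-! ### Block interleaving: functoriality and the underlying permutation -/

/-- Block interleaving commutes with `List.map`. [folklore] -/
theorem interleave_map {α β : Type*} (f : α → β) :
    ∀ (p : List Step) (s t : List ℕ) (xs ys : List α),
      interleave p s t (xs.map f) (ys.map f) = (interleave p s t xs ys).map f
  | [], s, t, xs, ys => by simp
  | Step.X :: p, [], t, xs, ys => by simp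
  | Step.X :: p, a :: s, t, xs, ys => by
    rw [interleave_X_cons, interleave_X_cons, ← List.map_drop, interleave_map f p s t,
      ← List.map_take, List.map_append]
  | Step.Y :: p, s, [], xs, ys => by simp
  | Step.Y :: p, s, b :: t, xs, ys => by
    rw [interleave_Y_cons, interleave_Y_cons, ← List.map_drop, interleave_map f p s t,
      ← List.map_take, List.map_append]
  | Step.D :: p, [], t, xs, ys => by simp
  | Step.D :: p, a :: s, [], xs, ys => by simp
  | Step.D :: p, a :: s, b :: t, xs, ys => by
    rw [interleave_D_cons, interleave_D_cons, ← List.map_drop, ← List.map_drop,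
      interleave_map f p s t, ← List.map_take, ← List.map_take, List.map_append,
      List.map_append]

open scoped List in
/-- Block interleaving along a path consuming exactly `s` and `t` permutes `xs ++ ys` (for
coordinate lists of lengths `weight s`, `weight t`). [folklore] -/
theorem interleave_perm {α : Type*} : ∀ (p : List Step) (s t : List ℕ) (xs ys : List α),
    cx p = s.length → cy p = t.length → xs.length = weight s → ys.length = weight t →
    (interleave p s t xs ys).Perm (xs ++ ys)
  | [], s, t, xs, ys, hs, ht, hx, hy => by
    rw [cx_nil] at hs
    rw [cy_nil] at ht
    obtain rfl := List.eq_nil_of_length_eq_zero hs.symm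
    obtain rfl := List.eq_nil_of_length_eq_zero ht.symm
    rw [MZV.weight_nil] at hx hy
    obtain rfl := List.eq_nil_of_length_eq_zero hx
    obtain rfl := List.eq_nil_of_length_eq_zero hy
    simp
  | Step.X :: p, [], t, xs, ys, hs, _, _, _ => by simp at hs
  | Step.X :: p, a :: s, t, xs, ys, hs, ht, hx, hy => by
    rw [cx_cons_X, List.length_cons, Nat.add_right_cancel_iff] at hs
    rw [cy_cons_X] at ht
    rw [weight_cons_eq] at hx
    have ih := interleave_perm p s t (xs.drop a) ys hs ht (by rw [List.length_drop]; omega) hy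
    rw [interleave_X_cons]
    calc xs.take a ++ interleave p s t (xs.drop a) ys
      _ ~ xs.take a ++ (xs.drop a ++ ys) := ih.append_left _
      _ = xs ++ ys := by rw [← List.append_assoc, List.take_append_drop]
  | Step.Y :: p, s, [], xs, ys, _, ht, _, _ => by simp at ht
  | Step.Y :: p, s, b :: t, xs, ys, hs, ht, hx, hy => by
    rw [cx_cons_Y] at hs
    rw [cy_cons_Y, List.length_cons, Nat.add_right_cancel_iff] at ht
    rw [weight_cons_eq] at hy
    have ih := interleave_perm p s t xs (ys.drop b) hs ht hx (by rw [List.length_drop]; omega)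
    rw [interleave_Y_cons]
    calc ys.take b ++ interleave p s t xs (ys.drop b)
      _ ~ ys.take b ++ (xs ++ ys.drop b) := ih.append_left _
      _ ~ xs ++ (ys.take b ++ ys.drop b) := List.perm_append_comm_assoc _ _ _
      _ = xs ++ ys := by rw [List.take_append_drop]
  | Step.D :: p, [], t, xs, ys, hs, _, _, _ => by simp at hs
  | Step.D :: p, a :: s, [], xs, ys, _, ht, _, _ => by simp at ht
  | Step.D :: p, a :: s, b :: t, xs, ys, hs, ht, hx, hy => by
    rw [cx_cons_D, List.length_cons, Nat.add_right_cancel_iff] at hs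
    rw [cy_cons_D, List.length_cons, Nat.add_right_cancel_iff] at ht
    rw [weight_cons_eq] at hx hy
    have ih := interleave_perm p s t (xs.drop a) (ys.drop b) hs ht
      (by rw [List.length_drop]; omega) (by rw [List.length_drop]; omega)
    rw [interleave_D_cons]
    calc xs.take a ++ (ys.take b ++ interleave p s t (xs.drop a) (ys.drop b))
      _ ~ xs.take a ++ (ys.take b ++ (xs.drop a ++ ys.drop b)) := (ih.append_left _).append_left _
      _ ~ xs.take a ++ (xs.drop a ++ (ys.take b ++ ys.drop b)) :=
          (List.perm_append_comm_assoc _ _ _).append_left _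
      _ = xs ++ ys := by rw [List.take_append_drop, ← List.append_assoc, List.take_append_drop]

/-! ### The key identity: the cube kernel of the merged index at interleaved coordinates -/

/-- `take (a + n)` of `l₁ ++ l₂` with `l₁.length = a` keeps `l₁` and takes `n` from `l₂`.
[folklore] -/
private theorem take_append_of_length_eq {α : Type*} {l₁ l₂ : List α} {a : ℕ}
    (h : l₁.length = a) (n : ℕ) : (l₁ ++ l₂).take (a + n) = l₁ ++ l₂.take n := by
  subst h
  exact List.take_length_add_append n

/-- The partial product of the interleaved coordinates up to the `m`-th cumulative position of the
merged index is the node product after `m` steps of the path.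
[cite: Souderes2010, §1.3 Prop. 1.5] -/
theorem prod_take_interleave : ∀ (p : List Step) (s t : List ℕ) (xs ys : List ℝ) (m : ℕ),
    cx p = s.length → cy p = t.length → xs.length = weight s → ys.length = weight t →
    ((interleave p s t xs ys).take ((merge p s t).take m).sum).prod = nodeProd s t p xs ys m
  | [], s, t, xs, ys, m, _, _, _, _ => by simp [nodeProd]
  | _ :: _, s, t, xs, ys, 0, _, _, _, _ => by simp [nodeProd]
  | Step.X :: p, [], t, xs, ys, _ + 1, hs, _, _, _ => by simp at hs
  | Step.X :: p, a :: s, t, xs, ys, m + 1, hs, ht, hx, hy => by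
    rw [cx_cons_X, List.length_cons, Nat.add_right_cancel_iff] at hs
    rw [cy_cons_X] at ht
    rw [weight_cons_eq] at hx
    have ha : (xs.take a).length = a := by rw [List.length_take]; omega
    have ih := prod_take_interleave p s t (xs.drop a) ys m hs ht
      (by rw [List.length_drop]; omega) hy
    rw [interleave_X_cons, merge_X_cons, List.take_succ_cons, List.sum_cons,
      take_append_of_length_eq ha, List.prod_append, ih, nodeProd_def, nodeProd_def,
      List.take_succ_cons, cx_cons_X, cy_cons_X, List.take_succ_cons, List.sum_cons, List.take_add,
      List.prod_append]
    ring
  | Step.Y :: p, s, [], xs, ys, _ + 1, _, ht, _, _ => by simp at ht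
  | Step.Y :: p, s, b :: t, xs, ys, m + 1, hs, ht, hx, hy => by
    rw [cx_cons_Y] at hs
    rw [cy_cons_Y, List.length_cons, Nat.add_right_cancel_iff] at ht
    rw [weight_cons_eq] at hy
    have hb : (ys.take b).length = b := by rw [List.length_take]; omega
    have ih := prod_take_interleave p s t xs (ys.drop b) m hs ht hx
      (by rw [List.length_drop]; omega)
    rw [interleave_Y_cons, merge_Y_cons, List.take_succ_cons, List.sum_cons,
      take_append_of_length_eq hb, List.prod_append, ih, nodeProd_def, nodeProd_def,
      List.take_succ_cons, cx_cons_Y, cy_cons_Y, List.take_succ_cons, List.sum_cons, List.take_add,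
      List.prod_append]
    ring
  | Step.D :: p, [], t, xs, ys, _ + 1, hs, _, _, _ => by simp at hs
  | Step.D :: p, a :: s, [], xs, ys, _ + 1, _, ht, _, _ => by simp at ht
  | Step.D :: p, a :: s, b :: t, xs, ys, m + 1, hs, ht, hx, hy => by
    rw [cx_cons_D, List.length_cons, Nat.add_right_cancel_iff] at hs
    rw [cy_cons_D, List.length_cons, Nat.add_right_cancel_iff] at ht
    rw [weight_cons_eq] at hx hy
    have ha : (xs.take a).length = a := by rw [List.length_take]; omega
    have hb : (ys.take b).length = b := by rw [List.length_take]; omega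
    have ih := prod_take_interleave p s t (xs.drop a) (ys.drop b) m hs ht
      (by rw [List.length_drop]; omega) (by rw [List.length_drop]; omega)
    rw [interleave_D_cons, merge_D_cons, List.take_succ_cons, List.sum_cons, Nat.add_assoc,
      take_append_of_length_eq ha, take_append_of_length_eq hb, List.prod_append, List.prod_append,
      ih, nodeProd_def, nodeProd_def,
      List.take_succ_cons, cx_cons_D, cy_cons_D, List.take_succ_cons, List.take_succ_cons,
      List.sum_cons, List.sum_cons, List.take_add, List.take_add, List.prod_append,
      List.prod_append]
    ring

/-- **The key identity of the transport step**: the cube kernel of the merged index `merge p s t` at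
the block-interleaved coordinates is the path kernel of `p`.
[cite: Souderes2010, §1.3 Prop. 1.5] -/
theorem cubeKernel_merge_interleave (p : List Step) (s t : List ℕ) (xs ys : List ℝ)
    (hs : cx p = s.length) (ht : cy p = t.length) (hx : xs.length = weight s)
    (hy : ys.length = weight t) :
    cubeKernel (merge p s t) (interleave p s t xs ys) = pathKernel s t p xs ys := by
  rw [cubeKernel_def, pathKernel_def, length_merge p s t hs ht]
  refine Finset.prod_congr rfl fun m _ => ?_
  rw [prod_take_interleave p s t xs ys m hs ht hx hy,
    prod_take_interleave p s t xs ys (m + 1) hs ht hx hy]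

/-! ### The block-interleaving permutation -/

/-- The interleaved index list is an enumeration of `Fin (a + b)` (a permutation of
`List.finRange (a + b)`: the `x`-indices `castAdd b` followed by the `y`-indices `natAdd a` list
`Fin (a + b)`, `Fin.append_castAdd_natAdd`, cf. the sibling line's
`MzvKernelInKZ.TwoPosets.ofFn_castAdd_append_ofFn_natAdd`). [folklore] -/
theorem interleave_idx_perm (p : List Step) (s t : List ℕ) (hs : cx p = s.length)
    (ht : cy p = t.length) :
    (interleave p s t
      (List.ofFn (Fin.castAdd (weight t) : Fin (weight s) → Fin (weight s + weight t)))
      (List.ofFn (Fin.natAdd (weight s)))).Perm (List.finRange (weight s + weight t)) := by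
  have h : List.finRange (weight s + weight t) =
      List.ofFn (Fin.castAdd (weight t) : Fin (weight s) → Fin (weight s + weight t)) ++
        List.ofFn (Fin.natAdd (weight s) : Fin (weight t) → Fin (weight s + weight t)) := by
    rw [← List.ofFn_fin_append, ← List.ofFn_id]
    exact congrArg List.ofFn (Fin.append_castAdd_natAdd (f := id)).symm
  rw [h]
  exact interleave_perm p s t _ _ hs ht List.length_ofFn List.length_ofFn

/-- Listing a list along a cast of its index type, composed with a map. [folklore] -/
theorem ofFn_get_cast {α β : Type*} (L : List α) {n : ℕ} (h : n = L.length) (g : α → β) :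
    List.ofFn (fun i : Fin n => g (L.get (Fin.cast h i))) = L.map g := by
  subst h
  rw [← List.ofFn_getElem_eq_map]
  rfl

/-! ### The stub -/

/-- **Stub `stub_termTransport`** (term transport: one coordinate permutation per path).  For a step
list `p` consuming exactly `|s|` entries of `s` and `|t|` of `t`: the merged index has weight
`weight s + weight t`, and for every cube representation `C = [(0,1)^{|u|}, cubeKernel u]` of
`u = merge p s t` there is a representation `R` on the cube `(0,1)^{a+b}` whose integrand is (on the
cube) the path kernel `pathKernel s t p (x-coordinates) (y-coordinates)` with
`[R] − [C] ∈ KZ.relations`: `R := C.reindex e` for the block-interleaving permutation `e`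
(`List.Nodup.getEquivOfForallMemList` of the interleaved index list), a change-of-variables move
(`KZ.of_sub_of_reindex_mem_relations`); the integrand identity is `cubeKernel_merge_interleave`.
[cite: KontsevichZagier2001, §1.2 rule (2)] -/
theorem stub_termTransport : ∀ (s t : List ℕ) (p : List Step), cx p = s.length → cy p = t.length →
    weight (merge p s t) = weight s + weight t ∧
    ∀ C : IntegralRep (weight (merge p s t)), C.domain = openCube (weight (merge p s t)) →
      Set.EqOn C.integrand (fun w => cubeKernel (merge p s t) (List.ofFn w)) C.domain →
      ∃ R : IntegralRep (weight s + weight t), R.domain = openCube (weight s + weight t) ∧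
        Set.EqOn R.integrand (fun z => pathKernel s t p
          (List.ofFn fun i => z (Fin.castAdd (weight t) i))
          (List.ofFn fun j => z (Fin.natAdd (weight s) j))) R.domain ∧
        of R - of C ∈ relations := by
  intro s t p hs ht
  have hw : weight (merge p s t) = weight s + weight t := weight_merge p s t hs ht
  refine ⟨hw, fun C hCd hCi => ?_⟩
  -- the index list of the block interleaving and the permutation it defines
  set L : List (Fin (weight s + weight t)) := interleave p s t
    (List.ofFn (Fin.castAdd (weight t) : Fin (weight s) → Fin (weight s + weight t)))
    (List.ofFn (Fin.natAdd (weight s))) with hL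
  have hperm : L.Perm (List.finRange (weight s + weight t)) := interleave_idx_perm p s t hs ht
  have hnd : L.Nodup := hperm.nodup_iff.mpr (List.nodup_finRange _)
  have hall : ∀ x, x ∈ L := fun x => hperm.mem_iff.mpr (List.mem_finRange x)
  have hlen : weight (merge p s t) = L.length := by
    rw [hperm.length_eq, List.length_finRange, hw]
  let e : Fin (weight (merge p s t)) ≃ Fin (weight s + weight t) :=
    (finCongr hlen).trans (hnd.getEquivOfForallMemList L hall)
  have he : ∀ i, e i = L.get (Fin.cast hlen i) := fun i => rfl
  have hlist : ∀ z : Fin (weight s + weight t) → ℝ, List.ofFn (fun i => z (e i)) =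
      interleave p s t (List.ofFn fun i => z (Fin.castAdd (weight t) i))
        (List.ofFn fun j => z (Fin.natAdd (weight s) j)) := by
    intro z
    simp only [he]
    rw [ofFn_get_cast L hlen z, hL, ← interleave_map, List.map_ofFn, List.map_ofFn]
    rfl
  refine ⟨C.reindex e, ?_, ?_, ?_⟩
  · -- the cube is invariant under coordinate permutations
    rw [IntegralRep.reindex_domain, hCd]
    ext w
    simp only [mem_setOf_eq, mem_openCube]
    constructor
    · intro h j
      simpa using h (e.symm j)
    · intro h i
      exact h (e i)
  · -- the integrand: the key identity at the interleaved coordinates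
    intro z hz
    have hz' : (fun i => z (e i)) ∈ C.domain := hz
    calc (C.reindex e).integrand z
      _ = C.integrand (fun i => z (e i)) := rfl
      _ = cubeKernel (merge p s t) (List.ofFn fun i => z (e i)) := hCi hz'
      _ = cubeKernel (merge p s t) (interleave p s t
            (List.ofFn fun i => z (Fin.castAdd (weight t) i))
            (List.ofFn fun j => z (Fin.natAdd (weight s) j))) := by rw [hlist z]
      _ = _ := cubeKernel_merge_interleave p s t _ _ hs ht List.length_ofFn List.length_ofFn
  · -- one change-of-variables move
    rw [← neg_sub]
    exact relations.neg_mem (of_sub_of_reindex_mem_relations C e)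

end Summit.KontsevichZagierPeriods.FurushoPentagon.StuffleInKZ
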